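import Mathlib
import Summits.Ventures.HodgeRepro0.P4K3LatticeDefsG
import Summits.Ventures.HodgeRepro0.P4K3LatticeG1
import Summits.Ventures.HodgeRepro0.P4K3LatticeG2
import Summits.Ventures.HodgeRepro0.P4K3LatticeG3
import Summits.Ventures.HodgeRepro0.P4K3LatticeG4

/-!
# P4K3LatticeG (seat p4) — `|det G| = 3125` from the four kernel-evaluated products

See `P4K3LatticeDefsG` (and `DefsGp`, `DefsM`) for the data and the paper side (proofs/p4-k3-route-check.md §4). Assembles the diagonalisation
`P * G * Q = Matrix.diagonal d` from the product modules and reads off the determinant; no heavy evaluation here.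
-/

namespace HodgeRepro0.P4K3Lattice

/-- Diagonalisation of `G` by unimodular matrices. -/
theorem P_G_Q : P * G * Q = Matrix.diagonal d := by
  rw [P_mul_G, PGm_mul_Q, Dm_eq]

/-- `|det G| = 3125`. -/
theorem abs_det_G : |G.det| = 3125 := by
  have h := congrArg Matrix.det P_G_Q
  rw [Matrix.det_mul, Matrix.det_mul, Matrix.det_diagonal] at h
  have hP := det_unit_of_mul_eq_one P_mul_Pinv
  have hQ := det_unit_of_mul_eq_one Q_mul_Qinv
  have hd : ∏ i, d i = -3125 := by rw [← FinVec.prod_eq]; rfl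
  rw [hd] at h
  have : |P.det| * |G.det| * |Q.det| = 3125 := by rw [← abs_mul, ← abs_mul, h]; norm_num
  rw [hP, hQ] at this; simpa using this

end HodgeRepro0.P4K3Lattice
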